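import Summits.QuantumFields.YangMills.Theorems.UnitScaleTiltProp7StubEXOfDensityLift
import HarnessLib

/-!
# Route `UnitScaleTilt`, crux K1 child «MinimiserStabilityRegPr» (stmt-QuantumFields-19200), stub `stub_existenceMinimalOrbit` (EX), route (α), DENSITY line (★★OWNER RULING g28-№8 (B)) —
# **THE DISPLAYED ROW `hIrrLift` OF THE «CtrD» DISPLAY TWINS, AT THE `Lift` TEXT OF RECORD, IS A THEOREM (all `L > 1`, `B₃ := 3L`)** — the all-`L` form of ✓p675347
# `Prop7StubEXOfDensityLift.irrLift_T3`, stated BYTE-FOR-BYTE as the binder `hIrrLift` of `…StubEXOfDisplayedRowsWWSECtrD` ∕ … ∕ `…StubEXOfChartPiecesTwS9PCtrD` with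
# `Lift L i U₀ :=` the lift antecedent of record (HOME `ym-ust-19200-w2/g6/HLIFT-ANTECEDENT-OF-RECORD.w2g6.txt`; = the `hSplit′` antecedent of the display of record S9″ ✓p676326).

Cell `ym3-torus`, width seat `ym3-torus-px10` (gen 3).  THEOREMS ONLY (0 `def`, 0 `sorry`).  `--supports stmt-QuantumFields-19200 --as helper`, count-neutral.
HONEST SCOPE.  One-line instantiation (`B₃ := 3L`, `0 < 3L`); nothing of [Balaban1985Variational] is asserted; no display flip is claimed; YM₃ on T³ = rung R3 — not d = 4, not Clay, no mass gap.

References: T. Bałaban, CMP 102 (1985) 277–309 [Balaban1985Variational] ((3)–(6) p.278, (14) p.280); CMP 99 (1985) 389–434 [Balaban1985BackgroundPropagators] ((3.19)–(3.21) pp.393–394).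
-/

set_option autoImplicit false

noncomputable section

open scoped Matrix.Norms.L2Operator

namespace Summit.QuantumFields.YangMills.Theorems.Prop7IrrLiftRowOfRecord

open Literature.MathematicalPhysics.QuantumFieldTheory.Balaban1983to89
open Literature.MathematicalPhysics.QuantumFieldTheory.Balaban1983to89.T3ContinuumYM3Torus
open Literature.MathematicalPhysics.QuantumFieldTheory.Balaban1983to89.T3UnitLawDensityEML (ℰp)
open T3PrintedRegularMinimiser (RegPr)
open T3Thm1Carrier (Idx)
open T3ConstrainedMinimiser (fibre)
open T3SectALandauChart (bgUnits)
open B15DeterminingSets (embIter)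
open Summit.QuantumFields.YangMills.Theorems.Prop8Chart (emlIterU)
open Summit.QuantumFields.YangMills.Theorems.Prop7StubEXOfDensityLift (irrLift_T3)

/-- ★★ **THE ROW `hIrrLift` OF THE «CtrD» DISPLAY TWINS AT THE `Lift` TEXT OF RECORD, ALL `L > 1` (`B₃ := 3L`)**: over an irreducible datum every printed-regular fibre point of radius `L³·3L·ε₁`,
`ε₁ ≤ aI L`, carries the lift antecedent of record. [cite: Balaban1985Variational, (3)-(6) p.278, (14) p.280; Balaban1985BackgroundPropagators, (3.19)-(3.21) pp.393-394] -/
theorem hIrrLift_of_record : ∀ (L : ℕ), 1 < L → ∃ aI : ℝ, 0 < aI ∧ ∀ (i : Idx L) (ε₁ : ℝ), 0 < ε₁ → ε₁ ≤ aI →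
    ∀ (V : GaugeField (i.1.1.P i.1.2.1) 0 (Matrix.specialUnitaryGroup (Fin 2) ℂ)) (U₀ : GaugeField (i.1.1.P i.1.2.2) 0 (Matrix.specialUnitaryGroup (Fin 2) ℂ)),
      (∀ cf : Site (i.1.1.P i.1.2.1) 0 → Matrix (Fin 2) (Fin 2) ℂ,
          (∀ b : PBond (i.1.1.P i.1.2.1) 0, cf b.src * ((V b : Matrix.specialUnitaryGroup (Fin 2) ℂ) : Matrix (Fin 2) (Fin 2) ℂ) =
            ((V b : Matrix.specialUnitaryGroup (Fin 2) ℂ) : Matrix (Fin 2) (Fin 2) ℂ) * cf b.tgt) →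
          ∃ z : ℂ, ∀ y : Site (i.1.1.P i.1.2.1) 0, cf y = z • (1 : Matrix (Fin 2) (Fin 2) ℂ)) →
      PlaqSmall ε₁ V → RegPr i.1.1 i.1.2.1 i.1.2.2 ((L : ℝ) ^ 3 * (3 * (L : ℝ)) * ε₁) U₀ → U₀ ∈ fibre i.1.1 ℰp i.1.2.1 i.1.2.2 i.2.2.le V →
      -- the `Lift` antecedent of record at `(L, i, U₀)`
      (∀ cf : Site (i.1.1.P i.1.2.2) (i.1.2.2 - i.1.2.1) → Matrix (Fin 2) (Fin 2) ℂ,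
        (∀ e' : PBond (i.1.1.P i.1.2.2) (i.1.2.2 - i.1.2.1), cf e'.src = ((emlIterU (i.1.2.2 - i.1.2.1) (bgUnits i.1.1 i.1.2.2 U₀) e' : (Matrix (Fin 2) (Fin 2) ℂ)ˣ) : Matrix (Fin 2) (Fin 2) ℂ) * cf e'.tgt *
          (((emlIterU (i.1.2.2 - i.1.2.1) (bgUnits i.1.1 i.1.2.2 U₀) e')⁻¹ : (Matrix (Fin 2) (Fin 2) ℂ)ˣ) : Matrix (Fin 2) (Fin 2) ℂ)) →
        ∃ l₀ : Site (i.1.1.P i.1.2.2) 0 → Matrix (Fin 2) (Fin 2) ℂ,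
          (∀ b' : PBond (i.1.1.P i.1.2.2) 0, l₀ b'.src = ((bgUnits i.1.1 i.1.2.2 U₀ b' : (Matrix (Fin 2) (Fin 2) ℂ)ˣ) : Matrix (Fin 2) (Fin 2) ℂ) * l₀ b'.tgt * (((bgUnits i.1.1 i.1.2.2 U₀ b')⁻¹ : (Matrix (Fin 2) (Fin 2) ℂ)ˣ) : Matrix (Fin 2) (Fin 2) ℂ)) ∧
          ∀ y : Site (i.1.1.P i.1.2.2) (i.1.2.2 - i.1.2.1), l₀ (embIter (i.1.2.2 - i.1.2.1) y) = cf y) := by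
  intro L hL
  have h3L : (0 : ℝ) < 3 * (L : ℝ) := by
    have hL0 : (0 : ℝ) < (L : ℝ) := by exact_mod_cast (lt_trans zero_lt_one hL)
    positivity
  exact irrLift_T3 hL h3L

end Summit.QuantumFields.YangMills.Theorems.Prop7IrrLiftRowOfRecord

end
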